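import Summits.PneNP.PneNP.Theorems.ChebyshevTracialDesignTracialProfilePolynomial
import Summits.PneNP.PneNP.Theorems.ChebyshevTracialDesignVirtualValueUnique
import Summits.PneNP.PneNP.Theorems.ChebyshevTracialDesignBoundedDimension
import Summits.PneNP.PneNP.Theses.ChebyshevTracialDesign
import HarnessLib

/-!
# Cell pnp-psdrank, route `ChebyshevTracialDesign`: the crux `TracialDecayExp20` FOLLOWS from virtual nonnegativity of
# entrywise-truncated psd strategies — the two-layer plan (ATT ⇒ VIRT ⇒ decay) as ONE implication, (ATT) and the tail discharged

Harmonic backbone of the crux `TracialDecayExp20` (stmt-PneNP-19878), brick 21 (prover g7). Brick 20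
(`…TracialProfilePolynomial.tracialValueLEAt_of_virtualNonneg`) bounds the tracial value of an exact design on every psd rectangle of
dimension `r` by `ε + B·√P_D` as soon as the averaged Grigoriev pseudo-expectation of the entrywise degree-`≤ D` truncation of the
strategy is `≥ −ε·r`, where `P_D = Π_{i ≤ D/2} (2i+1)/(n−2i)`. Here the tail is made ASYMPTOTICALLY NEGLIGIBLE at the route's scale:
* `prod_atten_le_pow` — `P_D ≤ ρ^{D/2+1}` with `ρ = (2D+1)/(n−2D)`;
* `sqrt_prod_atten_small` — for every `a > 0` there is `n₀` with `20·√P_{dq n} ≤ exp(−a·dq n)/2` for all `n ≥ n₀`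
  (`dq n = ⌊n^{1/4}⌋`; via `ρ ≤ 6/(dq n)³ → 0`, no real powers; `le_dq_of_pow_le` reused from `…BoundedDimension`);
* `tracialDecayExp20_of_virtualNonneg` — **if, for some `a > 0` and all large even `n`, every balanced exact design
  `(t, C, w)` of degree `dq n` (levels `≤ Tq n`, `Σ|w_c| ≤ 20`), every `r > 0` with `r²·n < exp(a·dq n)`, every tight-orthogonal psd
  rectangle `(X, Y)` of dimension `r` and every harmonic layer datum `p` of the entries of `X` on the `t`-cuts satisfy
  `(1/|PM_n|)·Σ_M Σ_{|A| ≤ dq n} tr(Q_A Y_M)·knapsackMoment(|M|, t/2, |M[A]|) ≥ −(exp(−a·dq n)/2)·r`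
  (VIRTUAL NONNEGATIVITY at the exp scale), then `TracialDecayExp20`** — by name, with the same rate `a`.
So the crux is REDUCED, in the kernel, to the sign of one averaged pseudo-expectation; nothing else of the route's plan remains open at
any dimension. [cite: Rothvoss2017, §2 (PDF pp. 6–8)] [cite: Grigoriev2001, Lemma 1.4 (PDF p. 8)] [cite: GriblingDelaatLaurent2019, §5]
[cite: CoppersmithRivlin1992, Thm. (p. 970)]
Stature: support/instrument (a conditional reduction of the crux; the hypothesis is the open heart). WHAT THIS IS NOT: no decay is
proved; nothing on psd rank; no P-vs-NP content. Supports stmt-PneNP-19878.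
-/

set_option linter.dupNamespace false -- `Summit.PneNP.PneNP.…`: summit = sub-problem (D-0017)

noncomputable section

namespace Summit.PneNP.PneNP.Theorems.ChebyshevTracialDesignVirtualReduction

open Finset Matrix Polynomial Literature.Barriers.PneNP Literature.Combinatorics.Optimization Literature.Computability.Complexity
open Literature.Combinatorics.AssociationSchemes Literature.Combinatorics.AssociationSchemes.JohnsonHarmonics
open Literature.Combinatorics.AssociationSchemes.JohnsonSpectrum
open Summit.PneNP.PneNP.Theorems.ChebyshevTracialDesignLevelTail
open Summit.PneNP.PneNP.Theorems.ChebyshevTracialDesignProfilePolynomial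
open Summit.PneNP.PneNP.Theorems.ChebyshevTracialDesignTracialProfilePolynomial

variable {n : ℕ}

/-! ### §1 The attenuation product is eventually smaller than any `exp(−a·dq n)` -/

/-- `P_D ≤ ρ^{D/2+1}` with `ρ = (2D+1)/(n−2D)`, for `2D < n`: every factor `(2i+1)/(n−2i)`, `i ≤ D/2`, is at most `ρ`. -/
theorem prod_atten_le_pow {D : ℕ} (hD : 2 * D < n) :
    ∏ i ∈ range (D / 2 + 1), ((2 * i + 1 : ℝ) / ((n : ℝ) - 2 * i)) ≤
      ((2 * D + 1 : ℝ) / ((n : ℝ) - 2 * D)) ^ (D / 2 + 1) := by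
  have h1 : (0 : ℝ) < (n : ℝ) - 2 * D := by
    have : ((2 * D : ℕ) : ℝ) < n := by exact_mod_cast hD
    push_cast at this; linarith
  calc ∏ i ∈ range (D / 2 + 1), ((2 * i + 1 : ℝ) / ((n : ℝ) - 2 * i))
      ≤ ∏ _i ∈ range (D / 2 + 1), ((2 * D + 1 : ℝ) / ((n : ℝ) - 2 * D)) := by
        refine prod_le_prod (fun i hi => (atten_factor_le_one (by have := mem_range.1 hi; omega)).1) fun i hi => ?_
        have hiD : (i : ℝ) ≤ D := by exact_mod_cast (show i ≤ D by have := mem_range.1 hi; omega)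
        have h2 : (0 : ℝ) < (n : ℝ) - 2 * i := by linarith
        rw [div_le_div_iff₀ h2 h1]
        nlinarith [mul_nonneg (sub_nonneg.2 hiD) (Nat.cast_nonneg n)]
    _ = ((2 * D + 1 : ℝ) / ((n : ℝ) - 2 * D)) ^ (D / 2 + 1) := by rw [prod_const, card_range]

/-- `(dq n)^4 ≤ n`. [cite: CoppersmithRivlin1992, Thm. (p. 970)] -/
theorem dq_pow_four_le (n : ℕ) : dq n ^ 4 ≤ n := by
  have h1 : dq n * dq n ≤ Nat.sqrt n := Nat.sqrt_le (Nat.sqrt n)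
  have h2 : Nat.sqrt n * Nat.sqrt n ≤ n := Nat.sqrt_le n
  calc dq n ^ 4 = (dq n * dq n) * (dq n * dq n) := by ring
    _ ≤ Nat.sqrt n * Nat.sqrt n := Nat.mul_le_mul h1 h1
    _ ≤ n := h2

/-- **The tail is negligible at the exp scale**: for every `a > 0` there is `n₀` such that for all `n ≥ n₀`,
`2·dq n < n` and `20·√(P_{dq n}) ≤ exp(−a·dq n)/2`, `P_D = Π_{i<D/2+1} (2i+1)/(n−2i)`.
Mechanism: `ρ = (2D+1)/(n−2D) ≤ 6D/n ≤ 6/D³` (`D⁴ ≤ n`), so `ρ ≤ (e^{−2a}/40)²` for `D` large; then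
`√P_D ≤ (√ρ)^{D/2+1} ≤ (e^{−2a}/40)^{D/2+1} ≤ e^{−aD}/40`. [cite: CoppersmithRivlin1992, Thm. (p. 970)] -/
theorem sqrt_prod_atten_small {a : ℝ} (ha : 0 < a) :
    ∃ n₀ : ℕ, ∀ n : ℕ, n₀ ≤ n → 2 * dq n < n ∧
      20 * Real.sqrt (∏ i ∈ range (dq n / 2 + 1), ((2 * i + 1 : ℝ) / ((n : ℝ) - 2 * i))) ≤
        Real.exp (-(a * (dq n : ℝ))) / 2 := by
  -- the target ratio bound `κ = σ²`, `σ = e^{−2a}/40`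
  set σ : ℝ := Real.exp (-(2 * a)) / 40 with hσ
  have hσpos : 0 < σ := by positivity
  have hσ1 : σ ≤ 1 := by
    have : Real.exp (-(2 * a)) ≤ 1 := Real.exp_le_one_iff.2 (by linarith)
    rw [hσ]; linarith
  set κ : ℝ := σ ^ 2 with hκ
  have hκpos : 0 < κ := by positivity
  -- choose `D₀ ≥ 2` with `6/D₀³ ≤ κ` (crudely: `D₀ ≥ 6/κ`), and `n₀ = D₀⁴`
  obtain ⟨D₀, hD₀⟩ := exists_nat_ge (6 / κ + 2)
  refine ⟨D₀ ^ 4, fun n hn => ?_⟩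
  have hDD : D₀ ≤ dq n := Summit.PneNP.PneNP.Theorems.ChebyshevTracialDesignBoundedDim.le_dq_of_pow_le hn
  set D := dq n with hDdef
  have hD4 : D ^ 4 ≤ n := dq_pow_four_le n
  have hD₀2 : (2 : ℝ) ≤ D₀ := by
    have : (0 : ℝ) ≤ 6 / κ := by positivity
    linarith
  have hD2 : 2 ≤ D := by
    have : (2 : ℝ) ≤ (D₀ : ℝ) := hD₀2
    have h2 : 2 ≤ D₀ := by exact_mod_cast this
    exact h2.trans hDD
  have h4D : 4 * D ≤ n := by
    have h8 : 2 ^ 3 ≤ D ^ 3 := Nat.pow_le_pow_left hD2 3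
    have : 4 * D ≤ D ^ 4 := by
      calc 4 * D ≤ D ^ 3 * D := Nat.mul_le_mul_right D (by omega)
        _ = D ^ 4 := by ring
    exact this.trans hD4
  have h2D : 2 * D < n := by omega
  refine ⟨h2D, ?_⟩
  -- `ρ ≤ 6/D³ ≤ κ`
  have hDpos : (0 : ℝ) < D := by exact_mod_cast (show 0 < D by omega)
  have hnR : ((D : ℝ)) ^ 4 ≤ n := by exact_mod_cast hD4
  have hden : (0 : ℝ) < (n : ℝ) - 2 * D := by
    have : ((2 * D : ℕ) : ℝ) < n := by exact_mod_cast h2D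
    push_cast at this; linarith
  have hρκ : (2 * D + 1 : ℝ) / ((n : ℝ) - 2 * D) ≤ κ := by
    rw [div_le_iff₀ hden]
    -- `2D+1 ≤ 3D`, `n − 2D ≥ n/2 ≥ D⁴/2`, and `κ·D³ ≥ 6`
    have h3 : (2 * D + 1 : ℝ) ≤ 3 * D := by
      have : (2 : ℝ) ≤ D := by exact_mod_cast hD2
      linarith
    have hκD : 6 ≤ κ * D := by
      have : (6 : ℝ) / κ ≤ D₀ - 2 := by linarith
      have hD₀D : (D₀ : ℝ) ≤ D := by exact_mod_cast hDD
      have : 6 / κ ≤ D := by linarith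
      rwa [div_le_iff₀ hκpos, mul_comm] at this
    have h4 : (n : ℝ) - 2 * D ≥ (n : ℝ) / 2 := by
      have : ((4 * D : ℕ) : ℝ) ≤ n := by exact_mod_cast h4D
      push_cast at this; linarith
    -- `κ (n − 2D) ≥ κ n/2 ≥ κ D⁴/2 = (κ D)·D³/2 ≥ 3 D³ ≥ 3D ≥ 2D+1`
    have hD1 : (1 : ℝ) ≤ D := by exact_mod_cast (show 1 ≤ D by omega)
    have hD3 : (0 : ℝ) ≤ (D : ℝ) ^ 3 := by positivity
    calc (2 * D + 1 : ℝ) ≤ 3 * D := h3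
      _ ≤ 3 * (D : ℝ) ^ 3 := by nlinarith [mul_nonneg (sub_nonneg.2 hD1) hDpos.le]
      _ ≤ κ * D * (D : ℝ) ^ 3 / 2 := by nlinarith [hκD, hD3]
      _ = κ * (D : ℝ) ^ 4 / 2 := by ring
      _ ≤ κ * n / 2 := by nlinarith [hnR, hκpos.le]
      _ ≤ κ * ((n : ℝ) - 2 * D) := by nlinarith [h4, hκpos.le]
  -- `P_D ≤ ρ^{k} ≤ κ^{k} = (σ^{k})²`, `k = D/2+1`
  have hρ0 : 0 ≤ (2 * D + 1 : ℝ) / ((n : ℝ) - 2 * D) := div_nonneg (by positivity) hden.le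
  have hP : ∏ i ∈ range (D / 2 + 1), ((2 * i + 1 : ℝ) / ((n : ℝ) - 2 * i)) ≤ (σ ^ (D / 2 + 1)) ^ 2 := by
    refine (prod_atten_le_pow h2D).trans ?_
    rw [← pow_mul, mul_comm (D / 2 + 1) 2, pow_mul, ← hκ]
    exact pow_le_pow_left₀ hρ0 hρκ _
  have hsqrt : Real.sqrt (∏ i ∈ range (D / 2 + 1), ((2 * i + 1 : ℝ) / ((n : ℝ) - 2 * i))) ≤ σ ^ (D / 2 + 1) := by
    rw [← Real.sqrt_sq (pow_nonneg hσpos.le (D / 2 + 1))]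
    exact Real.sqrt_le_sqrt hP
  -- `σ^{k} ≤ e^{−aD}/40`
  have hk : σ ^ (D / 2 + 1) ≤ Real.exp (-(a * (D : ℝ))) / 40 := by
    have hk1 : 1 ≤ D / 2 + 1 := by omega
    have h2k : D ≤ 2 * (D / 2 + 1) := by omega
    -- `σ^k = e^{−2ak}/40^k ≤ e^{−2ak}/40 ≤ e^{−aD}/40`
    have hexp : Real.exp (-(2 * a)) ^ (D / 2 + 1) ≤ Real.exp (-(a * (D : ℝ))) := by
      rw [← Real.exp_nat_mul, Real.exp_le_exp]
      have : (D : ℝ) ≤ 2 * ((D / 2 + 1 : ℕ) : ℝ) := by exact_mod_cast h2k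
      nlinarith
    have h40 : (1 : ℝ) / 40 ^ (D / 2 + 1) ≤ 1 / 40 := by
      apply div_le_div_of_nonneg_left (by norm_num) (by norm_num)
      exact le_self_pow₀ (by norm_num) (by omega)
    calc σ ^ (D / 2 + 1) = Real.exp (-(2 * a)) ^ (D / 2 + 1) * (1 / 40 ^ (D / 2 + 1)) := by
          rw [hσ, div_pow]; ring
      _ ≤ Real.exp (-(a * (D : ℝ))) * (1 / 40) :=
          mul_le_mul hexp h40 (by positivity) (by positivity)
      _ = Real.exp (-(a * (D : ℝ))) / 40 := by ring
  calc 20 * Real.sqrt (∏ i ∈ range (D / 2 + 1), ((2 * i + 1 : ℝ) / ((n : ℝ) - 2 * i)))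
      ≤ 20 * (Real.exp (-(a * (D : ℝ))) / 40) := mul_le_mul_of_nonneg_left (hsqrt.trans hk) (by norm_num)
    _ = Real.exp (-(a * (D : ℝ))) / 2 := by ring

/-! ### §2 The reduction of the crux to virtual nonnegativity -/

/-- `dq n + 3 ≤ Tq n`: the exactness degree is below the top planted level. -/
theorem dq_add_three_le_Tq (n : ℕ) : dq n + 3 ≤ Tq n := by
  unfold dq Tq
  have := Nat.sqrt_le_self (Nat.sqrt n)
  omega

/-- Monotonicity of the tracial value bound in the threshold. -/
theorem tracialValueLEAt_mono {W : OddSet n → PMatch n → ℝ} {γ γ' : ℝ} {r : ℕ} (h : TracialValueLEAt W γ r) (hγ : γ ≤ γ') :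
    TracialValueLEAt W γ' r :=
  fun X Y hXY => (h X Y hXY).trans hγ

/-- **`TracialDecayExp20` from virtual nonnegativity.** If for some `a > 0` and all large even `n`, for every balanced exact design
`(t, C, w)` of degree `dq n` on levels `≤ Tq n` with `Σ|w_c| ≤ 20`, every dimension `r > 0` with `r²·n < exp(a·dq n)`, every
tight-orthogonal psd rectangle `(X, Y)` of dimension `r` (`IsPsdRect X Y`) and every harmonic layer datum `p` of the entries of `X` on
the `t`-cuts, the averaged Grigoriev pseudo-expectation of the entrywise degree-`≤ dq n` truncation of `X` against `Y` is
`≥ −(exp(−a·dq n)/2)·r`, then the crux `TracialDecayExp20` holds (with the same rate `a`).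
[cite: Rothvoss2017, §2 (PDF pp. 6–8)] [cite: Grigoriev2001, Lemma 1.4 (PDF p. 8)] [cite: GriblingDelaatLaurent2019, §5] -/
theorem tracialDecayExp20_of_virtualNonneg {a : ℝ} (ha : 0 < a)
    (hV : ∃ n₁ : ℕ, ∀ n : ℕ, n₁ ≤ n → Even n → ∀ (t : ℕ) (C : Finset ℕ) (w : ℕ → ℝ),
      IsBalancedDesign n t (Tq n) (dq n) 20 C w → ∀ r : ℕ, 0 < r → (r : ℝ) ^ 2 * n < Real.exp (a * (dq n : ℝ)) →
        ∀ (X : OddSet n → Matrix (Fin r) (Fin r) ℝ) (Y : PMatch n → Matrix (Fin r) (Fin r) ℝ), IsPsdRect X Y →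
          ∀ p : Fin r × Fin r → ℕ → Finset (Fin n) → ℝ, (∀ ab j, IsHarmonic j (p ab j)) →
            (∀ ab (U : OddSet n), U.1.card = t →
              X U ab.1 ab.2 = (∑ j ∈ range (t + 1), up^[t - j] (p ab j)) U.1) →
            -(Real.exp (-(a * (dq n : ℝ))) / 2 * r) ≤
              (Fintype.card (PMatch n) : ℝ)⁻¹ * ∑ M : PMatch n, ∑ A : {A : Finset (Fin n) // A.card ≤ dq n},
                (Matrix.of (fun a' b' : Fin r =>
                  (∑ j ∈ range (t + 1), ((t - j).factorial : ℝ) • (if dq n < j then 0 else p (a', b') j)) A.1) *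
                    Y M).trace *
                  knapsackMoment M.1.card ((t : ℝ) / 2) (M.1.filter fun e => ∃ v ∈ A.1, v ∈ e).card) :
    Summit.PneNP.PneNP.Theses.ChebyshevTracialDesign.TracialDecayExp20 := by
  obtain ⟨n₁, hn₁⟩ := hV
  obtain ⟨n₀, hn₀⟩ := sqrt_prod_atten_small ha
  refine ⟨a, ha, max n₀ n₁, fun n hn hev t C w hdes r hr hbud => ?_⟩
  have hn0 : n₀ ≤ n := le_trans (le_max_left _ _) hn
  have hn1 : n₁ ≤ n := le_trans (le_max_right _ _) hn
  obtain ⟨-, htail⟩ := hn₀ n hn0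
  have hex : IsExactDesign n t (Tq n) (dq n) 20 C w := hdes.1
  obtain ⟨c', rfl⟩ : ∃ c', t = 2 * c' + 1 := hex.1
  have hD : dq n ≤ 2 * c' := by
    have h1 := dq_add_three_le_Tq n
    have h2 : Tq n ≤ 2 * c' + 1 := hex.2.2.1
    omega
  have hvirt := fun X Y (hXY : IsPsdRect X Y) p hp hpdec =>
    hn₁ n hn1 hev (2 * c' + 1) C w hdes r hr hbud X Y hXY p hp hpdec
  have h := tracialValueLEAt_of_virtualNonneg (ε := Real.exp (-(a * (dq n : ℝ))) / 2) hev hex hD hr hvirt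
  refine tracialValueLEAt_mono h ?_
  linarith

/-! ### §3 The converse reduction and the equivalence (appended, prover g7 brick 22b)

With the route-independent uniqueness of harmonic layer data (`…VirtualValueUnique.tracial_value_truncation_of_data`) the
implication of §2 is reversed: `TracialDecayExp20` at rate `a` gives virtual nonnegativity at rate `a/2`
(`virtualNonneg_of_tracialDecayExp20`), whence **`tracialDecayExp20_iff_virtualNonneg : TracialDecayExp20 ↔ ∃ a > 0, VIRT(a)`** —
the crux of the route is, by name and in the kernel, EQUIVALENT to virtual nonnegativity of entrywise-truncated tight psd strategies at
the exp scale (MEMO-9 §2(b)). -/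

section Converse

open Summit.PneNP.PneNP.Theorems.ChebyshevTracialDesignVirtualValueUnique

/-- `3·exp(−a·D) ≤ exp(−(a/2)·D)` once `a·D/2 ≥ 2`. -/
theorem three_mul_exp_le {a D : ℝ} (h : 2 ≤ a / 2 * D) : 3 * Real.exp (-(a * D)) ≤ Real.exp (-(a / 2 * D)) := by
  have h3 : 3 ≤ Real.exp (a / 2 * D) := le_trans (by linarith) (Real.add_one_le_exp _)
  have hsplit : Real.exp (-(a * D)) = Real.exp (-(a / 2 * D)) * Real.exp (-(a / 2 * D)) := by
    rw [← Real.exp_add]; ring_nf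
  have hinv : Real.exp (-(a / 2 * D)) * 3 ≤ 1 := by
    rw [Real.exp_neg]
    calc (Real.exp (a / 2 * D))⁻¹ * 3 ≤ (Real.exp (a / 2 * D))⁻¹ * Real.exp (a / 2 * D) :=
          mul_le_mul_of_nonneg_left h3 (inv_nonneg.2 (Real.exp_pos _).le)
      _ = 1 := inv_mul_cancel₀ (Real.exp_pos _).ne'
  rw [hsplit]
  nlinarith [Real.exp_pos (-(a / 2 * D)), hinv]

/-- **`TracialDecayExp20 ⇒` virtual nonnegativity** (the converse of brick 21): if the crux holds with rate `a`, then for all large even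
`n`, every balanced exact design `(t, C, w)` of degree `dq n` (levels `≤ Tq n`, `Σ|w_c| ≤ 20`), every `r > 0` with
`r²·n < exp((a/2)·dq n)`, every tight-orthogonal psd rectangle of dimension `r` and EVERY harmonic datum, the averaged Grigoriev
pseudo-expectation of the entrywise truncation is `≥ −(exp(−(a/2)·dq n)/2)·r`. [cite: Rothvoss2017, §2 (PDF pp. 6–8)]
[cite: Grigoriev2001, Lemma 1.4 (PDF p. 8)] [cite: GriblingDelaatLaurent2019, §5] -/
theorem virtualNonneg_of_tracialDecayExp20 (h : Summit.PneNP.PneNP.Theses.ChebyshevTracialDesign.TracialDecayExp20) :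
    ∃ a : ℝ, 0 < a ∧ ∃ n₁ : ℕ, ∀ n : ℕ, n₁ ≤ n → Even n → ∀ (t : ℕ) (C : Finset ℕ) (w : ℕ → ℝ),
      IsBalancedDesign n t (Tq n) (dq n) 20 C w → ∀ r : ℕ, 0 < r → (r : ℝ) ^ 2 * n < Real.exp (a * (dq n : ℝ)) →
        ∀ (X : OddSet n → Matrix (Fin r) (Fin r) ℝ) (Y : PMatch n → Matrix (Fin r) (Fin r) ℝ), IsPsdRect X Y →
          ∀ p : Fin r × Fin r → ℕ → Finset (Fin n) → ℝ, (∀ ab j, IsHarmonic j (p ab j)) →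
            (∀ ab (U : OddSet n), U.1.card = t →
              X U ab.1 ab.2 = (∑ j ∈ range (t + 1), up^[t - j] (p ab j)) U.1) →
            -(Real.exp (-(a * (dq n : ℝ))) / 2 * r) ≤
              (Fintype.card (PMatch n) : ℝ)⁻¹ * ∑ M : PMatch n, ∑ A : {A : Finset (Fin n) // A.card ≤ dq n},
                (Matrix.of (fun a' b' : Fin r =>
                  (∑ j ∈ range (t + 1), ((t - j).factorial : ℝ) • (if dq n < j then 0 else p (a', b') j)) A.1) *
                    Y M).trace *
                  knapsackMoment M.1.card ((t : ℝ) / 2) (M.1.filter fun e => ∃ v ∈ A.1, v ∈ e).card := by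
  obtain ⟨a, ha, n₁, hn₁⟩ := h
  obtain ⟨n₀, hn₀⟩ := sqrt_prod_atten_small ha
  -- `dq n ≥ 4/a` eventually, so that `3 e^{−aD} ≤ e^{−(a/2)D}`
  obtain ⟨D₀, hD₀⟩ := exists_nat_ge (4 / a)
  refine ⟨a / 2, by positivity, max (max n₀ n₁) (D₀ ^ 4), fun n hn hev t C w hdes r hr hbud X Y hXY p hp hpdec => ?_⟩
  have hn0 : n₀ ≤ n := le_trans (le_trans (le_max_left _ _) (le_max_left _ _)) hn
  have hn1 : n₁ ≤ n := le_trans (le_trans (le_max_right _ _) (le_max_left _ _)) hn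
  have hnD : D₀ ^ 4 ≤ n := le_trans (le_max_right _ _) hn
  have hDD : D₀ ≤ dq n := Summit.PneNP.PneNP.Theorems.ChebyshevTracialDesignBoundedDim.le_dq_of_pow_le hnD
  obtain ⟨-, htail⟩ := hn₀ n hn0
  have hex : IsExactDesign n t (Tq n) (dq n) 20 C w := hdes.1
  obtain ⟨c', rfl⟩ : ∃ c', t = 2 * c' + 1 := hex.1
  have ht : 2 * (2 * c' + 1) + 2 ≤ n := hex.2.1
  have hD : dq n ≤ 2 * c' := by
    have h1 := dq_add_three_le_Tq n
    have h2 : Tq n ≤ 2 * c' + 1 := hex.2.2.1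
    omega
  have hB := hex.2.2.2.2.2.2
  -- the crux at rate `a` applies: the budget `e^{(a/2)D}` is inside `e^{aD}`
  have hDnn : (0 : ℝ) ≤ (dq n : ℝ) := Nat.cast_nonneg _
  have hbud' : (r : ℝ) ^ 2 * n < Real.exp (a * (dq n : ℝ)) :=
    hbud.trans_le (Real.exp_le_exp.2 (by nlinarith))
  have hval := hn₁ n hn1 hev (2 * c' + 1) C w hdes r hr hbud' X Y hXY
  have hr' : (0 : ℝ) < r := by exact_mod_cast hr
  have hvalue : ∑ U : OddSet n, ∑ M : PMatch n, levelWeight n (2 * c' + 1) C w U M * (X U * Y M).trace ≤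
      (r : ℝ) * Real.exp (-(a * (dq n : ℝ))) := by
    have := (div_le_iff₀ hr').1 hval
    linarith
  -- the truncation theorem for the given datum, with the contraction tail
  have htr := tracial_value_truncation_of_data hev hex hD X Y p hp hpdec
  have hPm : (0 : ℝ) < Fintype.card (PMatch n) := by exact_mod_cast card_pmatch_pos hev
  have hCn : (0 : ℝ) < n.choose (2 * c' + 1) := by exact_mod_cast Nat.choose_pos (by omega)
  have hPD := prod_atten_nonneg (n := n) (K := dq n) (by omega)
  have htl := sqrt_tail_le_of_le hPD hCn hPm (Nat.cast_nonneg r)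
    (sum_nonneg fun M _ => by positivity) (sum_frobenius_cuts_le ⟨c', rfl⟩ hXY.1) (sum_frobenius_matchings_le hXY.2.1)
  have hw0 : 0 ≤ ∑ c ∈ C, |w c| := sum_nonneg fun c _ => abs_nonneg _
  have h1 := (abs_le.1 htr).1
  have h2 : (∑ c ∈ C, |w c|) *
      Real.sqrt ((∏ i ∈ range (dq n / 2 + 1), ((2 * i + 1 : ℝ) / ((n : ℝ) - 2 * i))) *
        ((∑ U : OddSet n, if U.1.card = 2 * c' + 1 then ∑ a, ∑ b, X U a b ^ 2 else 0) / (n.choose (2 * c' + 1) : ℝ)) *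
        ((∑ M : PMatch n, ∑ a, ∑ b, Y M a b ^ 2) / (Fintype.card (PMatch n) : ℝ))) ≤
      20 * ((r : ℝ) * Real.sqrt (∏ i ∈ range (dq n / 2 + 1), ((2 * i + 1 : ℝ) / ((n : ℝ) - 2 * i)))) :=
    mul_le_mul hB htl (Real.sqrt_nonneg _) (by norm_num)
  -- `3 e^{−aD} ≤ e^{−(a/2)D}`
  have h3 : 3 * Real.exp (-(a * (dq n : ℝ))) ≤ Real.exp (-(a / 2 * (dq n : ℝ))) := by
    refine three_mul_exp_le ?_
    have : (4 : ℝ) / a ≤ (dq n : ℝ) := hD₀.trans (by exact_mod_cast hDD)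
    have h4 : 4 ≤ a * (dq n : ℝ) := by
      have := mul_le_mul_of_nonneg_left this ha.le
      rwa [mul_div_cancel₀ _ ha.ne'] at this
    linarith
  have htail' : 20 * ((r : ℝ) * Real.sqrt (∏ i ∈ range (dq n / 2 + 1), ((2 * i + 1 : ℝ) / ((n : ℝ) - 2 * i)))) ≤
      (r : ℝ) * (Real.exp (-(a * (dq n : ℝ))) / 2) := by
    have := mul_le_mul_of_nonneg_left htail hr'.le
    linarith
  nlinarith [h1, h2, h3, htail', hvalue, hr'.le, Real.exp_pos (-(a * (dq n : ℝ)))]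

/-- **The crux is equivalent to virtual nonnegativity**: `TracialDecayExp20 ↔ ∃ a > 0, VIRT(a)`, where `VIRT(a)` is the hypothesis of
`…VirtualReduction.tracialDecayExp20_of_virtualNonneg` (averaged Grigoriev pseudo-expectation of the entrywise degree-`≤ dq n`
truncation of every tight-orthogonal psd rectangle of dimension `r`, `r²n < exp(a·dq n)`, against every balanced exact design's cut size,
is `≥ −(exp(−a·dq n)/2)·r`). [cite: Rothvoss2017, §2 (PDF pp. 6–8)] [cite: Grigoriev2001, Lemma 1.4 (PDF p. 8)]
[cite: GriblingDelaatLaurent2019, §5] -/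
theorem tracialDecayExp20_iff_virtualNonneg :
    Summit.PneNP.PneNP.Theses.ChebyshevTracialDesign.TracialDecayExp20 ↔
    ∃ a : ℝ, 0 < a ∧ ∃ n₁ : ℕ, ∀ n : ℕ, n₁ ≤ n → Even n → ∀ (t : ℕ) (C : Finset ℕ) (w : ℕ → ℝ),
      IsBalancedDesign n t (Tq n) (dq n) 20 C w → ∀ r : ℕ, 0 < r → (r : ℝ) ^ 2 * n < Real.exp (a * (dq n : ℝ)) →
        ∀ (X : OddSet n → Matrix (Fin r) (Fin r) ℝ) (Y : PMatch n → Matrix (Fin r) (Fin r) ℝ), IsPsdRect X Y →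
          ∀ p : Fin r × Fin r → ℕ → Finset (Fin n) → ℝ, (∀ ab j, IsHarmonic j (p ab j)) →
            (∀ ab (U : OddSet n), U.1.card = t →
              X U ab.1 ab.2 = (∑ j ∈ range (t + 1), up^[t - j] (p ab j)) U.1) →
            -(Real.exp (-(a * (dq n : ℝ))) / 2 * r) ≤
              (Fintype.card (PMatch n) : ℝ)⁻¹ * ∑ M : PMatch n, ∑ A : {A : Finset (Fin n) // A.card ≤ dq n},
                (Matrix.of (fun a' b' : Fin r =>
                  (∑ j ∈ range (t + 1), ((t - j).factorial : ℝ) • (if dq n < j then 0 else p (a', b') j)) A.1) *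
                    Y M).trace *
                  knapsackMoment M.1.card ((t : ℝ) / 2) (M.1.filter fun e => ∃ v ∈ A.1, v ∈ e).card :=
  ⟨virtualNonneg_of_tracialDecayExp20, fun ⟨_, ha, hV⟩ => tracialDecayExp20_of_virtualNonneg ha hV⟩

end Converse

end Summit.PneNP.PneNP.Theorems.ChebyshevTracialDesignVirtualReduction
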